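import Summits.CriticalPhenomena.PercolationContinuityZ3.Theorems.Transplant.GrigorchukLamplighterAutNotVirtuallyNilpotent
import Summits.CriticalPhenomena.PercolationContinuityZ3.Theorems.Transplant.AutChartOrbitsOneLampAutTransport
import Summits.CriticalPhenomena.PercolationContinuityZ3.Theorems.Transplant.GrigorchukLevelTransitive
import HarnessLib

/-!
# NO FC WITNESS for any finite-orbit group of automorphisms of `Cay(ℤ ≀_X 𝔊; a, b, c, d, s)` — the Aut-level twin (α-cov) of
# «GrigorchukLamplighterFCScope»: the COVERING ROUTE has no input on Bartholdi–Erschler's Cayley graph, from ANY group of automorphisms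

builds on p205010 (kernel theorem, internal audit signed; external expert review pending) — nothing in this file uses p205010.  NEGATIVE (scope) record about the
INPUT of the covering route (`AutCyl.conj4_of_orbitDatum_fc`, «AutEndStateFC»: a finite-orbit `A₀ ≤ Aut`, a character killing stabilisers, an element `g` with
`c g ≠ 1` whose centraliser has finite index); no percolation statement; nothing about any `@[conjecture]` (in particular nothing about
`BenjaminiSchramm1996_conj4_endState`); `θ(p_c) = 0` on this graph stays NOT PROVED.  Lane `prim-bschramm`, seat `prim-bschramm-p3` gen 36 (DESIGN OWNER;
`P3-NILPOTENT.md` §29.4, located item L-p5g31-3, lead g25 #7787).  Helper file (`--supports stmt-CriticalPhenomena-4575 --as helper`).  Def-free.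

THE ARGUMENT (`Grigorchuk.cay_no_fc_witness`).  Let `A₀ ≤ Aut(Cay)` have finitely many orbits, `c : A₀ → ℤ²` kill stabilisers, `c g ≠ 1`, `N ≤ C(g)` of finite
index.  (A) `N` contains, for every lamp position `x`, a pure translation by a power of `x` (uniform translations of `A₀`, «…OneLampAutTranslations», raised into
`N` by `exists_pow_mem_of_index_ne_zero`); commuting it with `g` and the left rule give `x^M = (T x T⁻¹)^{±M}`, so by FREENESS the tree part `T = treePart g`
fixes every position, i.e. `τ(g) ∈ 𝔊` fixes the orbit `𝔊·ρ` pointwise, hence (prefix preservation + level transitivity, p593398) `τ(g) = 1`.  (B) So `g²` is a pure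
translation by some lamp `m₂` («…AutSigns»), and `m₂ ≠ 1` because `c` kills stabilisers and `c g ≠ 1`.  (C) Every `α ∈ N` commutes with `g²`, so the
transport `Θ_α(m₂) = m₂` («…OneLampAutTransport»); reading lamps as finitely supported functions (§1: `Θ_α` moves the support by `τ(α)` up to signs) the tree
part `τ(α)` maps the finite non-empty support of `m₂` into itself.  (D) The tree parts of `N` form a finite-index subgroup of `𝔊` («…AutNotVirtuallyNilpotent»
§2), so the `𝔊`-orbit of a support point would be finite — but `𝔊`-orbits of rays are infinite (p593398 `exists_orbit_seq`).
[cite: BartholdiErschler2012, §2–§3.1] [cite: BenjaminiSchramm1996, Conj. 4; §2] [cite: MartineauSevero2019, Cor. 2.2]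
-/

noncomputable section

namespace Summit.CriticalPhenomena.PercolationContinuityZ3.Theorems.Transplant

namespace Grigorchuk

open SimpleGraph SemidirectProduct Literature.Probability.Percolation
open scoped Classical

/-! ### §1 Lamps as finitely supported functions; the transport moves supports by the tree part -/

/-- The lamp configuration of an element of `Γ₂`. [cite: BartholdiErschler2012, §2] -/
theorem lampsW_right_eq_one {m : ↥wreathZ} (hm : m ∈ lampsW) : ((m : LampGroup ℤ)).right = 1 := mem_lampsW.1 hm

/-- Configurations multiply additively inside the lamp subgroup. [folklore] -/
theorem toAdd_left_mul_of_mem_lampsW {m₁ m₂ : ↥wreathZ} (h₁ : m₁ ∈ lampsW) :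
    Multiplicative.toAdd (((m₁ * m₂ : ↥wreathZ)) : LampGroup ℤ).left =
      Multiplicative.toAdd ((m₁ : LampGroup ℤ)).left + Multiplicative.toAdd ((m₂ : LampGroup ℤ)).left := by
  rw [Subgroup.coe_mul, mul_left, mem_lampsW.1 h₁, map_one, MulAut.one_apply, toAdd_mul]

/-- The configuration of an inverse lamp. [folklore] -/
theorem toAdd_left_inv_of_mem_lampsW {m : ↥wreathZ} (h : m ∈ lampsW) :
    Multiplicative.toAdd (((m⁻¹ : ↥wreathZ)) : LampGroup ℤ).left = -Multiplicative.toAdd ((m : LampGroup ℤ)).left := by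
  rw [Subgroup.coe_inv, inv_left, mem_lampsW.1 h, inv_one, map_one, MulAut.one_apply, toAdd_inv]

/-- The configuration of a signed power of a position: `((T h) s (T h)⁻¹)^ε` has configuration `ε · δ_{(T h).right ρ}`. [folklore] -/
theorem toAdd_left_conj_zpow {t : ↥wreathZ} (ht : t ∈ treesW) (ε : ℤ) :
    Multiplicative.toAdd ((((t * sW * t⁻¹) ^ ε : ↥wreathZ)) : LampGroup ℤ).left = Finsupp.single (((t : LampGroup ℤ)).right rho) ε := by
  rw [Subgroup.coe_zpow, coe_conj_sW_of_mem_treesW ht, lamp_zpow, lamp_left, toAdd_ofAdd]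

section Action

variable {A : Type} [Group A] [MulAction A ↥wreathZ]

/-- The tree part of an acting element, as a permutation of the boundary. [folklore] -/
theorem treePart_mem_treesW (hA : frameW.LabelAction A) (α : A) : hA.treePart α ∈ treesW := hA.treePart_mem α

/-- **THE TRANSPORT MOVES CONFIGURATIONS BY THE TREE PART, UP TO SIGNS**: for every `α` there is a sign function `η : Ray → ℤ` (values `±1`) with
`conf(Θ_α m)(τ r) = η r · conf(m)(r)` for every lamp `m` and every ray `r`, where `τ = (treePart α).right`. [folklore] -/
theorem exists_sign_transport (hA : frameW.LabelAction A) (α : A) :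
    ∃ η : Ray → ℤ, (∀ r, η r = 1 ∨ η r = -1) ∧ ∀ m ∈ lampsW, ∀ r : Ray,
      Multiplicative.toAdd (((hA.transport α m : ↥wreathZ)) : LampGroup ℤ).left ((((hA.treePart α : ↥wreathZ)) : LampGroup ℤ).right r) =
        η r * Multiplicative.toAdd ((m : LampGroup ℤ)).left r := by
  -- the sign at a ray: the sign of `α` at any tree element carrying `ρ` to it (position-only), else `1`
  let η : Ray → ℤ := fun r => if h : ∃ t : ↥wreathZ, t ∈ treesW ∧ ((t : LampGroup ℤ)).right rho = r then hA.sgn α h.choose else 1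
  have hη1 : ∀ r, η r = 1 ∨ η r = -1 := by
    intro r
    simp only [η]
    split_ifs with h
    · exact hA.sgn_eq_or α _
    · exact Or.inl rfl
  have hηt : ∀ t : ↥wreathZ, t ∈ treesW → η (((t : LampGroup ℤ)).right rho) = hA.sgn α t := by
    intro t ht
    have hex : ∃ t' : ↥wreathZ, t' ∈ treesW ∧ ((t' : LampGroup ℤ)).right rho = ((t : LampGroup ℤ)).right rho := ⟨t, ht, rfl⟩
    simp only [η, dif_pos hex]
    -- position-only: both tree elements have the same position
    refine hA.sgn_of_pos_eq α ?_
    have h1 := hex.choose_spec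
    apply Subtype.ext
    show ((frameW.tr hex.choose * frameW.s * (frameW.tr hex.choose)⁻¹ : ↥wreathZ) : LampGroup ℤ) =
      ((frameW.tr t * frameW.s * (frameW.tr t)⁻¹ : ↥wreathZ) : LampGroup ℤ)
    rw [(frameW_tr _).1, (frameW_tr _).1, frameW_H.2]
    have e1 : trW hex.choose = hex.choose := Subtype.ext (coe_eq_inr_of_mem_treesW h1.1).symm
    have e2 : trW t = t := Subtype.ext (coe_eq_inr_of_mem_treesW ht).symm
    rw [e1, e2, coe_conj_sW_of_mem_treesW h1.1, coe_conj_sW_of_mem_treesW ht, h1.2]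
  refine ⟨η, hη1, ?_⟩
  -- closure induction over the positions
  set τ : Equiv.Perm Ray := (((hA.treePart α : ↥wreathZ)) : LampGroup ℤ).right with hτ
  have key : ∀ m ∈ Subgroup.closure {y : ↥wreathZ | ∃ h ∈ treesW, y = h * sW * h⁻¹}, ∀ r : Ray,
      Multiplicative.toAdd (((hA.transport α m : ↥wreathZ)) : LampGroup ℤ).left (τ r) = η r * Multiplicative.toAdd ((m : LampGroup ℤ)).left r := by
    intro m hm
    refine Subgroup.closure_induction (p := fun m _ => ∀ r : Ray,
      Multiplicative.toAdd (((hA.transport α m : ↥wreathZ)) : LampGroup ℤ).left (τ r) = η r * Multiplicative.toAdd ((m : LampGroup ℤ)).left r)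
      ?_ ?_ ?_ ?_ hm
    · rintro _ ⟨t, ht, rfl⟩ r
      have hTt : hA.treePart α * t ∈ treesW := treesW.mul_mem (treePart_mem_treesW hA α) ht
      rw [show hA.transport α (t * sW * t⁻¹) = (hA.treePart α * t * frameW.s * (hA.treePart α * t)⁻¹) ^ hA.sgn α t from
        hA.transport_conj α (frameW_H.1 ▸ ht), frameW_H.2, toAdd_left_conj_zpow hTt, ← zpow_one (t * sW * t⁻¹), toAdd_left_conj_zpow ht,
        Subgroup.coe_mul, mul_right, ← hτ, Equiv.Perm.mul_apply, Finsupp.single_apply, Finsupp.single_apply]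
      by_cases hr : ((t : LampGroup ℤ)).right rho = r
      · rw [if_pos (by rw [hr]), if_pos hr, ← hr, hηt t ht, mul_one]
      · rw [if_neg (fun h => hr (τ.injective h)), if_neg hr, mul_zero]
    · intro r
      rw [hA.transport_one, Subgroup.coe_one, one_left, toAdd_one, Finsupp.zero_apply, Finsupp.zero_apply, mul_zero]
    · intro x y hx hy ihx ihy r
      have hxL : x ∈ lampsW := frameW.closure_positions_le hx
      have hyL : y ∈ lampsW := frameW.closure_positions_le hy
      rw [hA.transport_mul α hxL hyL, toAdd_left_mul_of_mem_lampsW (hA.transport_mem α x), toAdd_left_mul_of_mem_lampsW hxL,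
        Finsupp.add_apply, Finsupp.add_apply, ihx, ihy, mul_add]
    · intro x hx ihx r
      have hxL : x ∈ lampsW := frameW.closure_positions_le hx
      rw [hA.transport_inv α hxL, toAdd_left_inv_of_mem_lampsW (hA.transport_mem α x), toAdd_left_inv_of_mem_lampsW hxL,
        Finsupp.neg_apply, Finsupp.neg_apply, ihx, mul_neg]
  intro m hm r
  exact key m (frameW.gen m hm) r

end Action

/-! ### §2 No FC witness -/

/-- An element of `𝔊` fixing the orbit `𝔊·ρ` pointwise is trivial (prefix preservation + level transitivity). [cite: Grigorchuk1980, 𝔊 ≤ Aut T₂] -/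
theorem eq_one_of_fix_orbit {g : Equiv.Perm Ray} (hg : g ∈ grigorchukGroup) (h : ∀ g' ∈ grigorchukGroup, g (g' rho) = g' rho) : g = 1 := by
  refine Equiv.ext fun r => funext fun i => ?_
  obtain ⟨g', hg', hagree⟩ := exists_apply_agree (i + 1) rho r
  have h1 := apply_agree (i + 1) hg (x := g' rho) (y := r) hagree i (by omega)
  rw [h g' hg'] at h1
  rw [Equiv.Perm.one_apply, ← h1, hagree i (by omega)]

/-- **(α-cov) NO FC WITNESS.**  For every subgroup `A₀ ≤ Aut(Cay)` with finitely many orbits, every character `c : A₀ → ℤ²` killing the stabilisers and every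
`g ∈ A₀` with `c g ≠ 1`, NO finite-index subgroup of `A₀` centralises `g` — the covering route's input (`AutCyl.conj4_of_orbitDatum_fc`) is absent from
Bartholdi–Erschler's Cayley graph at the level of `Aut(Cay)` (group-level record: «GrigorchukLamplighterFCScope» p593551).  `θ(p_c) = 0` here stays NOT PROVED.
[cite: BenjaminiSchramm1996, Conj. 4; §2] [cite: MartineauSevero2019, Cor. 2.2] -/
theorem cay_no_fc_witness (A₀ : Subgroup (Cay ≃g Cay)) (reps : Finset ↥wreathZ) (c : A₀ →* Multiplicative (Fin 2 → ℤ))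
    (horb : ∀ w : ↥wreathZ, ∃ a : A₀, ∃ s ∈ reps, (a : Cay ≃g Cay) s = w) (hstab : ∀ (a : A₀) (w : ↥wreathZ), (a : Cay ≃g Cay) w = w → c a = 1)
    (g : A₀) (hg : c g ≠ 1) (N : Subgroup A₀) [N.FiniteIndex] (hN : ∀ n ∈ N, n * g = g * n) : False := by
  letI : MulAction (Cay ≃g Cay) ↥wreathZ := AutChart.autMulAction Cay
  have hact : IsActionByAut Cay ↥A₀ := fun a x y => (a : Cay ≃g Cay).map_adj_iff
  have hA := labelAction_of_isActionByAut hact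
  have hRc : ∀ γ : ↥wreathZ, ∃ a : ↥A₀, ∃ r ∈ reps, a • r = γ := fun γ => horb γ
  obtain ⟨τ, hτ⟩ := exists_treeHom hA
  -- (A) the tree part of `g` is trivial
  obtain ⟨T, hT1, hTH⟩ := hA.exists_uniform_translation reps hRc
  have hfix : ∀ t ∈ treesW, hA.treePart g * t * frameW.s * (hA.treePart g * t)⁻¹ = t * frameW.s * t⁻¹ := by
    intro t ht
    obtain ⟨β, hβ⟩ := hTH t (frameW_H.1 ▸ ht)
    obtain ⟨n, hn, -, hβn⟩ := N.exists_pow_mem_of_index_ne_zero Subgroup.FiniteIndex.index_ne_zero β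
    -- `β^n ∈ N` translates by `(t s t⁻¹)^(T n)` and commutes with `g`
    have hβn' : ∀ γ, (β ^ n) • γ = (t * frameW.s * t⁻¹) ^ (T * n) * γ := fun γ => by
      rw [OneLampFrame.LabelAction.pow_smul_eq_pow_mul hβ n γ, ← pow_mul]
    have hcomm := hN _ hβn
    have e : ∀ γ, (t * frameW.s * t⁻¹) ^ (T * n) * (g • γ) =
        (hA.treePart g * t * frameW.s * (hA.treePart g * t)⁻¹) ^ (hA.sgn g t * (T * n : ℕ)) * (g • γ) := fun γ => by
      rw [← hβn', ← mul_smul, hcomm, mul_smul, hβn', ← zpow_natCast, hA.smul_conj_zpow_mul g (frameW_H.1 ▸ ht)]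
    have e1 := mul_right_cancel (e 1)
    by_contra hne
    have hTg : hA.treePart g * t ∈ frameW.H := frameW.H.mul_mem (hA.treePart_mem g) (frameW_H.1 ▸ ht)
    have h0 := (frameW.free t (frameW_H.1 ▸ ht) (hA.treePart g * t) hTg (Ne.symm hne) _ _ (by rw [zpow_natCast]; exact e1)).1
    have : (T * n : ℤ) ≠ 0 := by exact_mod_cast Nat.mul_ne_zero (by omega) hn.ne'
    exact this (by exact_mod_cast h0)
  have hτg : (τ g : ↥grigorchukGroup) = 1 := by
    refine Subtype.ext (eq_one_of_fix_orbit (τ g).2 fun g' hg' => ?_)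
    have ht : (⟨tree g', tree_mem_wreathZ hg'⟩ : ↥wreathZ) ∈ treesW := mem_treesW.2 rfl
    have hTt : hA.treePart g * ⟨tree g', tree_mem_wreathZ hg'⟩ ∈ treesW := treesW.mul_mem (treePart_mem_treesW hA g) ht
    have h' : hA.treePart g * ⟨tree g', tree_mem_wreathZ hg'⟩ * sW * (hA.treePart g * ⟨tree g', tree_mem_wreathZ hg'⟩)⁻¹ =
        ⟨tree g', tree_mem_wreathZ hg'⟩ * sW * (⟨tree g', tree_mem_wreathZ hg'⟩)⁻¹ := hfix _ ht
    have h := congrArg (fun π : ↥wreathZ => Multiplicative.toAdd ((π : LampGroup ℤ)).left) h'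
    simp only [coe_conj_sW_of_mem_treesW hTt, coe_conj_sW_of_mem_treesW ht, lamp_left, toAdd_ofAdd] at h
    have h2 := Finsupp.single_left_injective (one_ne_zero (α := ℤ)) h
    rw [Subgroup.coe_mul, mul_right, Equiv.Perm.mul_apply, ← hτ] at h2
    exact h2
  have hTP : hA.treePart g = 1 := by
    refine eq_one_of_parts (mem_treesW.1 (treePart_mem_treesW hA g)) ?_
    rw [← hτ, hτg]; rfl
  -- (B) `g²` is a non-trivial pure translation
  obtain ⟨m₂, hm₂L, hm₂⟩ := hA.exists_sq_smul_eq_mul hTP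
  have hm₂L' : m₂ ∈ lampsW := hm₂L
  have hm₂ne : m₂ ≠ 1 := by
    intro h1
    apply hg
    have hs : ((g * g : ↥A₀) : Cay ≃g Cay) 1 = 1 := by
      show (g * g) • (1 : ↥wreathZ) = 1
      rw [hm₂, h1, mul_one]
    have h2 := hstab _ _ hs
    rw [map_mul] at h2
    have h3 : (2 : ℕ) • Multiplicative.toAdd (c g) = 0 := by
      rw [two_nsmul, ← toAdd_mul, h2, toAdd_one]
    have h4 := OneLampFrame.LabelAction.eq_zero_of_nsmul_eq_zero (by norm_num) h3
    exact toAdd_eq_zero.1 h4 ▸ rfl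
  -- (C) every `α ∈ N` has transport fixing `m₂`, so its tree part preserves the support of `m₂`
  set f₂ : Ray →₀ ℤ := Multiplicative.toAdd ((m₂ : LampGroup ℤ)).left with hf₂
  have hsupp : ∀ α ∈ N, ∀ r ∈ f₂.support, ((τ α : ↥grigorchukGroup) : Equiv.Perm Ray) r ∈ f₂.support := by
    intro α hα r hr
    have hcomm : α * (g * g) = g * g * α := by rw [← mul_assoc, hN α hα, mul_assoc, hN α hα, mul_assoc]
    have hΘ : hA.transport α m₂ = m₂ := hA.transport_eq_of_commute α hm₂L fun δ => by
      rw [← hm₂, ← mul_smul, hcomm, mul_smul, hm₂]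
    obtain ⟨η, hη1, hη⟩ := exists_sign_transport hA α
    have h := hη m₂ hm₂L' r
    rw [hΘ, ← hτ] at h
    rw [Finsupp.mem_support_iff] at hr ⊢
    rw [h]
    rcases hη1 r with e | e <;> rw [e] <;> simpa using hr
  -- (D) the tree parts of `N` have finite index in `𝔊`; the orbit of a support point would be finite
  haveI := finiteIndex_range_treeHom hA hτ reps hRc
  haveI : (N.map τ).FiniteIndex := by
    refine ⟨?_⟩
    rw [Subgroup.index_map]
    refine Nat.mul_ne_zero ?_ Subgroup.FiniteIndex.index_ne_zero
    have h := Subgroup.index_dvd_of_le (le_sup_left : N ≤ N ⊔ τ.ker)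
    exact fun h0 => Subgroup.FiniteIndex.index_ne_zero (Nat.eq_zero_of_zero_dvd (h0 ▸ h))
  have hne : f₂.support.Nonempty := by
    rw [Finsupp.support_nonempty_iff]
    intro h0
    exact hm₂ne (eq_one_of_parts (by rw [← ofAdd_toAdd ((m₂ : LampGroup ℤ)).left, ← hf₂, h0, ofAdd_zero]) (mem_lampsW.1 hm₂L'))
  obtain ⟨r₀, hr₀⟩ := hne
  -- every element of the finite-index subgroup `K = τ(N)` maps the support into itself
  have hK : ∀ k ∈ N.map τ, ∀ r ∈ f₂.support, (k : Equiv.Perm Ray) r ∈ f₂.support := by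
    rintro _ ⟨α, hα, rfl⟩ r hr
    exact hsupp α hα r hr
  -- the `𝔊`-orbit of `r₀` is covered by finitely many translates of the support
  have hcov : ∀ g' : ↥grigorchukGroup, ∃ q : ↥grigorchukGroup ⧸ N.map τ, (g' : Equiv.Perm Ray) r₀ ∈ (f₂.support : Set Ray).image (q.out : Equiv.Perm Ray) := by
    intro g'
    refine ⟨QuotientGroup.mk g', ?_⟩
    obtain ⟨k, hk⟩ := QuotientGroup.mk_out_eq_mul (N.map τ) g'
    refine ⟨((k : ↥grigorchukGroup) : Equiv.Perm Ray)⁻¹ r₀, hK _ ((N.map τ).inv_mem k.2) r₀ hr₀, ?_⟩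
    rw [hk, Subgroup.coe_mul, Equiv.Perm.mul_apply, ← Equiv.Perm.mul_apply (((k : ↥grigorchukGroup) : Equiv.Perm Ray)), mul_inv_cancel,
      Equiv.Perm.one_apply]
  have hfin : (Set.range fun g' : ↥grigorchukGroup => (g' : Equiv.Perm Ray) r₀).Finite := by
    refine (Set.finite_iUnion fun q : ↥grigorchukGroup ⧸ N.map τ => ((f₂.support : Set Ray).image (q.out : Equiv.Perm Ray)).toFinite).subset ?_
    rintro _ ⟨g', rfl⟩
    obtain ⟨q, hq⟩ := hcov g'
    exact Set.mem_iUnion.2 ⟨q, hq⟩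
  -- but it is infinite
  obtain ⟨r, hrinj, hr⟩ := exists_orbit_seq r₀ r₀ 0
  refine (Set.infinite_of_injective_forall_mem hrinj fun m => ?_) hfin
  obtain ⟨g', hg', hgr⟩ := (hr m).1
  exact ⟨⟨g', hg'⟩, hgr⟩

end Grigorchuk

end Summit.CriticalPhenomena.PercolationContinuityZ3.Theorems.Transplant
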